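import Summits.QuantumFields.YangMills.Theorems.BalabanUVNodesN09B0RiderAtRecord
import Summits.QuantumFields.YangMills.Theorems.BalabanUVNodesN09BetaInputContinuousOffChi29Thresholds
import Summits.QuantumFields.YangMills.Theorems.BalabanUVNodesN09ChartReadAveragingSmooth

/-!
# NODE N09 [B12] · THE LOCAL SUPPORT SET OF ROAD B AT THE RECORD: over the fibres of a solvable small coarse field the support of the β-input
# `ρ_j = χ^{(2.9)}_j·exp[…]` lies in the INTERIOR of the closed set «loops `≤ α` ∧ plaquettes `≤ B`», which sits inside the loop α-guard and inside `domAlt_j`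

Cell `pub-ymgap` (YM-PLAN Track A), DAG node N09 [Balaban1987RG1] (= [I]); width seat `pub-ymgap-dag-n09-w3` g6, FILE 2; count-neutral helper keyed to K1⁹
`StabilityBRunRowsAtRecordR13SepCoPHV` = stmt-QuantumFields-27364 (`--kind proof --supports … --as helper`).

WHY.  FILE 1 of this generation (`…N09RegularOnOfLoopSmallChi29Local.regularOn_of_loopSmall_chi29_local`) localises ROAD B to the fibres over an open coarse set
`D`: besides (I19), measurability and the continuity clause it displays a CLOSED set `K₀` of fine fields inside the loop α-guard with `ρ ≤ C₀` on `K₀` and the LOCAL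
SUPPORT CLAUSE `Ū U ∈ D → ρ U ≠ 0 → U ∈ interior K₀`; dag-n09-w2 g5's `hρc_betaInput_chi29_of_hcrit_of_continuousOn` wants moreover `K₀ ⊆ domAlt_j` (where the
tower delivers `GF_j`, `A_j` continuous).  THIS FILE names such a `K₀` at the Stage-13 letters and PROVES the local support clause for the record's β-input at
`D := domAltOfRecord θ₀.ν K (j+1)`: `K₀ := {U | (∀ c i, dist1 (loopHol U c i) ≤ α) ∧ ∀ p, dist1 (U(∂p)) ≤ B}` with the RIDER BOUND
`B := 2εreg∕L² + 4·max(ε₂₉, 10·((d+2)L)·L^{d−1}·ε₂₉)`.  Mechanism ([I] p. 259 and the p. 266–267 rider): on a solvable small coarse field `Ū U` ([B11] Thm 1, `hsolν`)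
the critical configuration `V^{(j)}(Ū U)` has `2εreg∕L²`-small plaquettes ([B7] Prop 2 — dag-n09-w1 g2's `hcrit_of_ukExists`); `χ^{(2.9)}_j(U) = 1` makes every
non-distinguished fluctuation variable `< ε₂₉` and — dag-n09-w4 g3's rider `hb0_of_hsolν_of_numerics` — every distinguished one `≤ 10ℓL^{d−1}ε₂₉`; hence EVERY plaquette
of `U` is STRICTLY below `B` (K0e's threshold-hierarchy computation `dist1_plaqHol_le_add` + `plaqDev_le_four_mul`, strict form) and every (0.4) loop is `≤ (ℓ²∕4)·B`
(`LatticeWordStokes.dist1_loopHol_le`); with the numerics `(ℓ²∕4)·B < α` the point `U` lies in the OPEN set «loops `< α` ∧ plaquettes `< B`» `⊆ K₀`, i.e. in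
`interior K₀`; and `B < ε₀` puts `K₀` inside `domAlt_j`.

WHAT IS PROVED (theorems only; 0 def, 0 sorry; axioms standard).
§1 generic sets: `isClosed_loopLe_inter_plaqLe`, `mem_interior_loopLe_inter_plaqLe`, `loopLe_of_mem`, `plaqSmall_of_mem_of_lt` (`K₀ ⊆ domAlt` when `B < ε₀`).
§2 ★ `plaqHol_lt_of_chiFix29_eq_one` (generic `ν`, the strict threshold-hierarchy inequality), ★★ `plaqHol_lt_of_hsolν_of_numerics`, `loopHol_le_of_hsolν_of_numerics` (at the
   Stage-13 letters, from `hsolν` + numerics).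
§3 ★★★ `mem_interior_localSupportSet_of_hsolν_of_numerics` (χ-form) and ★★★ `hρK_betaInputOfRecord_of_hsolν_of_numerics` — FILE 1's local support clause VERBATIM for
   `ρ_j := betaInputOfRecord T (chiβOfRecord₁₃ θ₀) K g j` (ANY transport `T`, ANY history `g`) at `D := domAltOfRecord θ₀.ν K (j+1)`, every `j < K`;
   `localSupportSet_subset_domAlt` (`B < θ₀.ν.ε₀`), `localSupportSet_subset_loopGuard`.
§4 ★★ `hρC_betaInput_chi29_of_continuousOn` — FILE 1's boundedness clause `∃ C₀, ∀ U ∈ K₀, ρ_k U ≤ C₀` for every closed `K₀` inside a set on which `GF_k`, `A_k` are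
   continuous (compactness of `SU(N)^{bonds}`, `0 ≤ χ^{(2.9)} ≤ 1`); `hρC_betaInputOfRecord_localSupportSet_of_continuousOn` (at the §3 set, `B < ε₀`).
§5 ★★ `hρc_betaInput_chi29_local_of_continuousOn_crit` — FILE 1's LOCAL continuity clause `∀ U ∈ K₀, Ū U ∈ D → (no non-distinguished threshold active) → ContinuousAt ρ_k U`
   from continuity of the critical configuration ON the open `D` (dag-n09-w1 g6's on-domain `hcrit` shape; DISPLAYED for the bare choice), `GF_k`∕`A_k` continuous near `K₀`,
   `K₀` in the guard; `hρc_betaInputOfRecord_localSupportSet_of_continuousOn_crit` (at the §3 set, `D := domAlt_{j+1}`, `Dk := domAlt_j`).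

HONEST SCOPE ∕ FRAMING.  LOCATED, count-neutral kernel bookkeeping BY NAME (dag-n09-w4 g3's rider, dag-n09-w1 g2's [B7]-Prop-2 face, K0e's threshold hierarchy, the tree's
Stokes bound); `hsolν` ([B11] Thm 1 existence on the domains) and the NUMERICS on the record's letters (`0 < εreg`, the two [B7]-numerics, the rider's two, `0 ≤ ε₂₉`,
`(ℓ²∕4)·B < α`, `B < ε₀`) are DISPLAYED, asserted of NO record (their joint satisfiability at the V19 witness is the K0-numerics lane's); NOTHING of Bałaban's asserted;
`hreg`∕(F3)∕`contTOn` NOT discharged; N09 NOT discharged; conjunct 1 (Lemma 4) ∕ FLAG №7 untouched; K0⁷ ∕ K1⁹ ∕ K2⁹ ∕ K3⁸ NOT closed; counts unmoved (typed 28∕28 ·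
discharged 5∕28); one finite four-torus programme at fixed `ε = L^{−K}` per run — R4 closes the conditional rung `BalabanLadder.UV` only; NOT ℝ⁴ ∕ infinite volume ∕ OS;
the Yang–Mills mass gap (Clay) is NOT proved by any of this.
-/

noncomputable section

open scoped Matrix.Norms.L2Operator Topology
open Filter Set Function MeasureTheory

namespace Summit.QuantumFields.YangMills.BalabanUVNodes.N09LocalSupportSetAtRecord

open Literature.MathematicalPhysics.QuantumFieldTheory.Balaban1983to89
open Literature.MathematicalPhysics.QuantumFieldTheory.Balaban1983to89.T4Continuum (T4Family)
open Literature.MathematicalPhysics.QuantumFieldTheory.Balaban1983to89.Node00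
open Literature.MathematicalPhysics.QuantumFieldTheory.Balaban1983to89.BlockAveraging (Idx loopHol)
open Literature.MathematicalPhysics.QuantumFieldTheory.Balaban1983to89.ExpMeanLog (deltaSU)
open Literature.MathematicalPhysics.QuantumFieldTheory.Balaban1983to89.T4TiltOscillation (bdev)
open Literature.MathematicalPhysics.QuantumFieldTheory.Balaban1983to89.T4ExpWindowSmallField (plaqDev dist1_plaqHol_le_add plaqDev_le_four_mul)
open Literature.MathematicalPhysics.QuantumFieldTheory.Balaban1983to89.B12ContinuousTransportInvarianceOn (continuous_dist1_SU continuous_plaqHol_SU)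
open Summit.QuantumFields.YangMills.BalabanUVNodes.N09B0RiderAtRecord (hb0_of_hsolν_of_numerics)
open Summit.QuantumFields.YangMills.BalabanUVNodes.N09NestingOfHierAxial (hcrit_of_ukExists)
open Summit.QuantumFields.YangMills.BalabanUVNodes.N09TransportPositiveOnDomainOfFibredChart (betaInput_chi29_apply betaInput_chi29_pos_iff betaInput_chi29_nonneg)
open Summit.QuantumFields.YangMills.BalabanUVNodes.N09BetaInputContinuousOffChi29Thresholds (not_isB0_iff continuousAt_fluctDevOfRecord_of_continuousAt_crit
  continuousAt_betaInput_chi29_of_forall_ne)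
open Summit.QuantumFields.YangMills.BalabanUVNodes.N09ChartReadAveragingSmooth (continuousAt_avgFun_of_small)
open Literature.MathematicalPhysics.QuantumFieldTheory.Balaban1983to89.BlockAveraging (Small)
open Literature.MathematicalPhysics.QuantumFieldTheory.Balaban1983to89.BlockAveragingHaarAC (centralBond)
open Literature.MathematicalPhysics.QuantumFieldTheory.Balaban1983to89.ExpMeanLog (expMeanLogSU)

variable {F : T4Family} {N : ℕ} [NeZero N]

/-! ## §1 The closed sets «loops `≤ α` ∧ plaquettes `≤ B`» -/

section Sets

variable {P : Params} {j : ℕ}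

/-- **«loops `≤ α` ∧ plaquettes `≤ B`» IS CLOSED** (finitely many non-strict inequalities of continuous functions of the configuration: `dist1` on `SU(N)`, the (0.4) loop
holonomies `BlockAveraging.continuous_loopHol`, the plaquette variables). [cite: Balaban1987RG1, (0.4) p.253 and p.259 (bookkeeping)] -/
theorem isClosed_loopLe_inter_plaqLe (α B : ℝ) :
    IsClosed {U : GaugeField P j (SU N) | (∀ c i, dist1 (loopHol U c i) ≤ α) ∧ ∀ p, dist1 (GaugeField.plaqHol U p) ≤ B} := by
  have h : {U : GaugeField P j (SU N) | (∀ c i, dist1 (loopHol U c i) ≤ α) ∧ ∀ p, dist1 (GaugeField.plaqHol U p) ≤ B} =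
      (⋂ c, ⋂ i, {U : GaugeField P j (SU N) | dist1 (loopHol U c i) ≤ α}) ∩ ⋂ p, {U | dist1 (GaugeField.plaqHol U p) ≤ B} := by
    ext U; simp only [mem_setOf_eq, mem_inter_iff, mem_iInter]
  rw [h]
  refine (isClosed_iInter fun c => isClosed_iInter fun i => ?_).inter (isClosed_iInter fun p => ?_)
  · exact isClosed_le (continuous_dist1_SU.comp ((continuous_apply i).comp (BlockAveraging.continuous_loopHol c))) continuous_const
  · exact isClosed_le (continuous_dist1_SU.comp (continuous_plaqHol_SU p)) continuous_const

/-- **STRICT smallness puts a configuration in the INTERIOR** of «loops `≤ α` ∧ plaquettes `≤ B`» (the strict set is open and contained in it).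
[cite: Balaban1987RG1, (0.4) p.253 and p.259 (bookkeeping)] -/
theorem mem_interior_loopLe_inter_plaqLe {α B : ℝ} {U : GaugeField P j (SU N)} (hloop : ∀ c i, dist1 (loopHol U c i) < α)
    (hplaq : ∀ p, dist1 (GaugeField.plaqHol U p) < B) :
    U ∈ interior {U : GaugeField P j (SU N) | (∀ c i, dist1 (loopHol U c i) ≤ α) ∧ ∀ p, dist1 (GaugeField.plaqHol U p) ≤ B} := by
  have h1 : IsOpen (⋂ c : PBond P (j + 1), ⋂ i : Idx P, {U : GaugeField P j (SU N) | dist1 (loopHol U c i) < α}) :=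
    isOpen_iInter_of_finite fun c => isOpen_iInter_of_finite fun i =>
      isOpen_lt (continuous_dist1_SU.comp ((continuous_apply i).comp (BlockAveraging.continuous_loopHol c))) continuous_const
  have h2 : IsOpen (⋂ p : Plaq P j, {U : GaugeField P j (SU N) | dist1 (GaugeField.plaqHol U p) < B}) :=
    isOpen_iInter_of_finite fun p => isOpen_lt (continuous_dist1_SU.comp (continuous_plaqHol_SU p)) continuous_const
  have hopen := h1.inter h2
  refine (hopen.subset_interior_iff.2 ?_) ?_
  · intro V hV
    simp only [mem_inter_iff, mem_iInter, mem_setOf_eq] at hV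
    exact ⟨fun c i => (hV.1 c i).le, fun p => (hV.2 p).le⟩
  · simp only [mem_inter_iff, mem_iInter, mem_setOf_eq]
    exact ⟨hloop, hplaq⟩

/-- The set lies inside the loop α-guard (projection). [cite: Balaban1987RG1, (0.4) p.253 (bookkeeping)] -/
theorem loopLe_of_mem {α B : ℝ} :
    ∀ U ∈ {U : GaugeField P j (SU N) | (∀ c i, dist1 (loopHol U c i) ≤ α) ∧ ∀ p, dist1 (GaugeField.plaqHol U p) ≤ B}, ∀ c i, dist1 (loopHol U c i) ≤ α :=
  fun _ hU => hU.1

/-- … and inside every plaquette-small set with a larger STRICT threshold: `B < δ ⇒ «… ≤ B» ⊆ {PlaqSmall δ}`. [cite: Balaban1987RG1, p.259 (bookkeeping)] -/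
theorem plaqSmall_of_mem_of_lt {α B δ : ℝ} (hBδ : B < δ) :
    ∀ U ∈ {U : GaugeField P j (SU N) | (∀ c i, dist1 (loopHol U c i) ≤ α) ∧ ∀ p, dist1 (GaugeField.plaqHol U p) ≤ B}, PlaqSmall δ U :=
  fun _ hU p => (hU.2 p).trans_lt hBδ

end Sets

/-! ## §2 The rider bound on the plaquettes and loops of the support, over a solvable small coarse field -/

/-- ★ **THE STRICT THRESHOLD-HIERARCHY INEQUALITY** (K0e's `mem_domAltOfRecord_of_chiFix29_eq_one`, with its bound exposed): if `χ^{(2.9)}_k(V) = 1`, the distinguished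
variables are `≤ ε₁′` and the critical configuration over `V̄` has `δ`-small plaquettes, then EVERY plaquette of `V` satisfies `|V(∂p) − 1| < δ + 4·max(ε₁, ε₁′)`
(`|∂V − 1| ≤ |∂V^{(k)} − 1| + Σ_{b⊂∂p}|V^{(k)}(b)⁻¹V(b) − 1|`). [cite: Balaban1987RG1, (2.9) p.266 and p.267; Balaban1988Convergent, p.265] -/
theorem plaqHol_lt_of_chiFix29_eq_one {ν : Stage7Numerics} {ε₁ ε₁' δ : ℝ} {K k : ℕ} {V : GaugeField (F.P K) k (SU N)}
    (hχ : chiFix29OfRecord F N ν ε₁ K k V = 1)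
    (hb0 : ∀ b : PBond (F.P K) k, IsB0 b → fluctDevOfRecord F N ν K k V b ≤ ε₁')
    (hcrit : PlaqSmall δ (critCfgOfRecord F N ν K k ((avOfRecord F N K k).avg V))) (p : Plaq (F.P K) k) :
    dist1 (GaugeField.plaqHol V p) < δ + 4 * max ε₁ ε₁' := by
  set V₀ := critCfgOfRecord F N ν K k ((avOfRecord F N K k).avg V)
  have hb : ∀ b, dist1 (bdev V V₀ b) ≤ max ε₁ ε₁' := by
    intro b
    by_cases h0 : IsB0 b
    · exact (hb0 b h0).trans (le_max_right _ _)
    · exact (le_of_lt ((chiFix29OfRecord_eq_one_iff ν ε₁ K k V).1 hχ b h0)).trans (le_max_left _ _)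
  calc dist1 (GaugeField.plaqHol V p) ≤ dist1 (GaugeField.plaqHol V₀ p) + plaqDev V V₀ p := dist1_plaqHol_le_add V V₀ p
    _ < δ + 4 * max ε₁ ε₁' := add_lt_add_of_lt_of_le (hcrit p) (plaqDev_le_four_mul hb p)

variable (θ₀ : Stage13Params F N) (K : ℕ) (g : ℕ → ℝ)

/-- ★★ **EVERY PLAQUETTE OF A SUPPORTED FINE FIELD OVER A SOLVABLE SMALL COARSE FIELD IS STRICTLY BELOW THE RIDER BOUND**
`B = 2εreg∕L² + 4·max(ε₂₉, 10·((d+2)L)·L^{d−1}·ε₂₉)`: for `j < K`, `Ū U ∈ domAlt_{j+1}` and `χ^{(2.9)}_j(U) = 1` — from `hsolν` ([B11] Thm 1 on the domains), [B7] Prop 2 at the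
record (`hcrit_of_ukExists`), dag-n09-w4 g3's rider `hb0_of_hsolν_of_numerics`, and numerics. [cite: Balaban1987RG1, (2.9) p.266, p.267 and p.259; Balaban1985Averaging, Prop. 2 (53) p.26] -/
theorem plaqHol_lt_of_hsolν_of_numerics (hεreg : 0 < θ₀.ν.εreg)
    (hε3 : (143 * (((((F.P K).d + 4 : ℕ) : ℝ)) ^ 2 / 4) ^ 2) * θ₀.ν.εreg ≤ 1 / 3)
    (hε2 : 2 * θ₀.ν.εreg ≤ 2 * deltaSU (Fin N) / ((((F.P K).d + 4) * (F.P K).L : ℕ) : ℝ) ^ 2) (hε29 : 0 ≤ θ₀.ε₂₉)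
    (hn1 : 1640 * (2 * (((((F.P K).d + 2) * (F.P K).L : ℕ) : ℝ) * θ₀.ε₂₉) +
        ((((F.P K).d + 2) * (F.P K).L : ℕ) : ℝ) ^ 2 / 4 * (2 * θ₀.ν.εreg / ((F.P K).L : ℝ) ^ 2)) * (((F.P K).L : ℝ) ^ ((F.P K).d - 1)) ^ 2 ≤ 1)
    (hn2 : 13 * (2 * (((((F.P K).d + 2) * (F.P K).L : ℕ) : ℝ) * θ₀.ε₂₉) +
        ((((F.P K).d + 2) * (F.P K).L : ℕ) : ℝ) ^ 2 / 4 * (2 * θ₀.ν.εreg / ((F.P K).L : ℝ) ^ 2)) * ((F.P K).L : ℝ) ^ ((F.P K).d - 1) < deltaSU (Fin N))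
    (hsolν : ∀ j < K, ∀ W ∈ domAltOfRecord F N θ₀.ν K (j + 1), UkExists F N K (j + 1) θ₀.ν.εreg W) :
    ∀ j < K, ∀ U : GaugeField (F.P K) j (SU N), (avOfRecord F N K j).avg U ∈ domAltOfRecord F N θ₀.ν K (j + 1) →
      chiβOfRecord₁₃ F N θ₀ K g j U = 1 → ∀ p : Plaq (F.P K) j, dist1 (GaugeField.plaqHol U p) <
        2 * θ₀.ν.εreg / ((F.P K).L : ℝ) ^ 2 + 4 * max θ₀.ε₂₉ (10 * (((((F.P K).d + 2) * (F.P K).L : ℕ) : ℝ) * θ₀.ε₂₉) * ((F.P K).L : ℝ) ^ ((F.P K).d - 1)) := by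
  intro j hj U havg hχ p
  have hL0 : (0 : ℝ) < (F.P K).L := by exact_mod_cast (F.P K).L_pos
  have hcrit : PlaqSmall (2 * θ₀.ν.εreg / ((F.P K).L : ℝ) ^ 2) (critCfgOfRecord F N θ₀.ν K j ((avOfRecord F N K j).avg U)) :=
    hcrit_of_ukExists θ₀.ν hεreg hε3 hε2 (by rw [div_mul_cancel₀ _ (by positivity)]) (hsolν j hj _ havg)
  have hb0 := hb0_of_hsolν_of_numerics θ₀ K g hεreg hε3 hε2 hε29 hn1 hn2 hsolν j hj U havg hχ
  have hχ' : chiFix29OfRecord F N θ₀.ν θ₀.ε₂₉ K j U = 1 := hχ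
  exact plaqHol_lt_of_chiFix29_eq_one hχ' hb0 hcrit p

/-- **… AND EVERY (0.4) LOOP IS `≤ (((d+2)L)²∕4)·B`** (the tree's Stokes bound `LatticeWordStokes.dist1_loopHol_le` on the `B`-small plaquettes).
[cite: Balaban1987RG1, (0.4) p.253 and p.259; Balaban1985Averaging, (19)–(20) p.21] -/
theorem loopHol_le_of_hsolν_of_numerics (hεreg : 0 < θ₀.ν.εreg)
    (hε3 : (143 * (((((F.P K).d + 4 : ℕ) : ℝ)) ^ 2 / 4) ^ 2) * θ₀.ν.εreg ≤ 1 / 3)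
    (hε2 : 2 * θ₀.ν.εreg ≤ 2 * deltaSU (Fin N) / ((((F.P K).d + 4) * (F.P K).L : ℕ) : ℝ) ^ 2) (hε29 : 0 ≤ θ₀.ε₂₉)
    (hn1 : 1640 * (2 * (((((F.P K).d + 2) * (F.P K).L : ℕ) : ℝ) * θ₀.ε₂₉) +
        ((((F.P K).d + 2) * (F.P K).L : ℕ) : ℝ) ^ 2 / 4 * (2 * θ₀.ν.εreg / ((F.P K).L : ℝ) ^ 2)) * (((F.P K).L : ℝ) ^ ((F.P K).d - 1)) ^ 2 ≤ 1)
    (hn2 : 13 * (2 * (((((F.P K).d + 2) * (F.P K).L : ℕ) : ℝ) * θ₀.ε₂₉) +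
        ((((F.P K).d + 2) * (F.P K).L : ℕ) : ℝ) ^ 2 / 4 * (2 * θ₀.ν.εreg / ((F.P K).L : ℝ) ^ 2)) * ((F.P K).L : ℝ) ^ ((F.P K).d - 1) < deltaSU (Fin N))
    (hsolν : ∀ j < K, ∀ W ∈ domAltOfRecord F N θ₀.ν K (j + 1), UkExists F N K (j + 1) θ₀.ν.εreg W) :
    ∀ j < K, ∀ U : GaugeField (F.P K) j (SU N), (avOfRecord F N K j).avg U ∈ domAltOfRecord F N θ₀.ν K (j + 1) →
      chiβOfRecord₁₃ F N θ₀ K g j U = 1 → ∀ c (i : Idx (F.P K)), dist1 (loopHol U c i) ≤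
        ((((F.P K).d + 2) * (F.P K).L : ℕ) : ℝ) ^ 2 / 4 *
          (2 * θ₀.ν.εreg / ((F.P K).L : ℝ) ^ 2 + 4 * max θ₀.ε₂₉ (10 * (((((F.P K).d + 2) * (F.P K).L : ℕ) : ℝ) * θ₀.ε₂₉) * ((F.P K).L : ℝ) ^ ((F.P K).d - 1))) := by
  intro j hj U havg hχ c i
  have hL0 : (0 : ℝ) < (F.P K).L := by exact_mod_cast (F.P K).L_pos
  have hB : 0 ≤ 2 * θ₀.ν.εreg / ((F.P K).L : ℝ) ^ 2 +
      4 * max θ₀.ε₂₉ (10 * (((((F.P K).d + 2) * (F.P K).L : ℕ) : ℝ) * θ₀.ε₂₉) * ((F.P K).L : ℝ) ^ ((F.P K).d - 1)) :=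
    add_nonneg (by positivity) (mul_nonneg (by norm_num) (hε29.trans (le_max_left _ _)))
  exact LatticeWordStokes.dist1_loopHol_le hB (plaqHol_lt_of_hsolν_of_numerics θ₀ K g hεreg hε3 hε2 hε29 hn1 hn2 hsolν j hj U havg hχ) c i

/-! ## §3 The local support clause of FILE 1 at the record -/

/-- ★★★ **THE SUPPORT OVER A SOLVABLE SMALL COARSE FIELD LIES IN THE INTERIOR OF «loops `≤ α` ∧ plaquettes `≤ B`»** (χ-form): for `j < K`, `Ū U ∈ domAlt_{j+1}` and
`χ^{(2.9)}_j(U) = 1` imply `U ∈ interior {W | (∀ c i, dist1 (loopHol W c i) ≤ α) ∧ ∀ p, |W(∂p) − 1| ≤ B}` as soon as `(((d+2)L)²∕4)·B < α` — plaquettes `< B` and loops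
`≤ (ℓ²∕4)·B < α` (§2), the strict set is open (§1). [cite: Balaban1987RG1, (0.4) p.253, p.259, (2.9) p.266 and p.267; Balaban1985Averaging, Prop. 2 (53) p.26 and (19) p.21] -/
theorem mem_interior_localSupportSet_of_hsolν_of_numerics (hεreg : 0 < θ₀.ν.εreg)
    (hε3 : (143 * (((((F.P K).d + 4 : ℕ) : ℝ)) ^ 2 / 4) ^ 2) * θ₀.ν.εreg ≤ 1 / 3)
    (hε2 : 2 * θ₀.ν.εreg ≤ 2 * deltaSU (Fin N) / ((((F.P K).d + 4) * (F.P K).L : ℕ) : ℝ) ^ 2) (hε29 : 0 ≤ θ₀.ε₂₉)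
    (hn1 : 1640 * (2 * (((((F.P K).d + 2) * (F.P K).L : ℕ) : ℝ) * θ₀.ε₂₉) +
        ((((F.P K).d + 2) * (F.P K).L : ℕ) : ℝ) ^ 2 / 4 * (2 * θ₀.ν.εreg / ((F.P K).L : ℝ) ^ 2)) * (((F.P K).L : ℝ) ^ ((F.P K).d - 1)) ^ 2 ≤ 1)
    (hn2 : 13 * (2 * (((((F.P K).d + 2) * (F.P K).L : ℕ) : ℝ) * θ₀.ε₂₉) +
        ((((F.P K).d + 2) * (F.P K).L : ℕ) : ℝ) ^ 2 / 4 * (2 * θ₀.ν.εreg / ((F.P K).L : ℝ) ^ 2)) * ((F.P K).L : ℝ) ^ ((F.P K).d - 1) < deltaSU (Fin N))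
    {α : ℝ} (hαB : ((((F.P K).d + 2) * (F.P K).L : ℕ) : ℝ) ^ 2 / 4 *
      (2 * θ₀.ν.εreg / ((F.P K).L : ℝ) ^ 2 + 4 * max θ₀.ε₂₉ (10 * (((((F.P K).d + 2) * (F.P K).L : ℕ) : ℝ) * θ₀.ε₂₉) * ((F.P K).L : ℝ) ^ ((F.P K).d - 1))) < α)
    (hsolν : ∀ j < K, ∀ W ∈ domAltOfRecord F N θ₀.ν K (j + 1), UkExists F N K (j + 1) θ₀.ν.εreg W) :
    ∀ j < K, ∀ U : GaugeField (F.P K) j (SU N), (avOfRecord F N K j).avg U ∈ domAltOfRecord F N θ₀.ν K (j + 1) →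
      chiβOfRecord₁₃ F N θ₀ K g j U = 1 →
        U ∈ interior {W : GaugeField (F.P K) j (SU N) | (∀ c i, dist1 (loopHol W c i) ≤ α) ∧ ∀ p, dist1 (GaugeField.plaqHol W p) ≤
          2 * θ₀.ν.εreg / ((F.P K).L : ℝ) ^ 2 + 4 * max θ₀.ε₂₉ (10 * (((((F.P K).d + 2) * (F.P K).L : ℕ) : ℝ) * θ₀.ε₂₉) * ((F.P K).L : ℝ) ^ ((F.P K).d - 1))} :=
  fun j hj U havg hχ => mem_interior_loopLe_inter_plaqLe
    (fun c i => (loopHol_le_of_hsolν_of_numerics θ₀ K g hεreg hε3 hε2 hε29 hn1 hn2 hsolν j hj U havg hχ c i).trans_lt hαB)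
    (plaqHol_lt_of_hsolν_of_numerics θ₀ K g hεreg hε3 hε2 hε29 hn1 hn2 hsolν j hj U havg hχ)

/-- ★★★ **FILE 1's LOCAL SUPPORT CLAUSE `hρK` FOR THE RECORD's β-INPUT, VERBATIM**: for every transport family `T`, history `g` and `j < K`, with
`ρ_j := betaInputOfRecord T (chiβOfRecord₁₃ θ₀) K g j = χ^{(2.9)}_j·exp[−GF_j∕g_j² + A_j]` (positive exactly where `χ^{(2.9)}_j = 1`; the χ slot is coupling-blind) and
`K₀ j := {W | (∀ c i, dist1 (loopHol W c i) ≤ α) ∧ ∀ p, |W(∂p) − 1| ≤ B}`: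
`∀ U, Ū U ∈ domAltOfRecord θ₀.ν K (j+1) → ρ_j U ≠ 0 → U ∈ interior (K₀ j)` — from `hsolν` + numerics only. [cite: Balaban1987RG1, (0.19) p.255, p.259, (2.9) p.266 and p.267] -/
theorem hρK_betaInputOfRecord_of_hsolν_of_numerics (T : Transport F N) (hεreg : 0 < θ₀.ν.εreg)
    (hε3 : (143 * (((((F.P K).d + 4 : ℕ) : ℝ)) ^ 2 / 4) ^ 2) * θ₀.ν.εreg ≤ 1 / 3)
    (hε2 : 2 * θ₀.ν.εreg ≤ 2 * deltaSU (Fin N) / ((((F.P K).d + 4) * (F.P K).L : ℕ) : ℝ) ^ 2) (hε29 : 0 ≤ θ₀.ε₂₉)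
    (hn1 : 1640 * (2 * (((((F.P K).d + 2) * (F.P K).L : ℕ) : ℝ) * θ₀.ε₂₉) +
        ((((F.P K).d + 2) * (F.P K).L : ℕ) : ℝ) ^ 2 / 4 * (2 * θ₀.ν.εreg / ((F.P K).L : ℝ) ^ 2)) * (((F.P K).L : ℝ) ^ ((F.P K).d - 1)) ^ 2 ≤ 1)
    (hn2 : 13 * (2 * (((((F.P K).d + 2) * (F.P K).L : ℕ) : ℝ) * θ₀.ε₂₉) +
        ((((F.P K).d + 2) * (F.P K).L : ℕ) : ℝ) ^ 2 / 4 * (2 * θ₀.ν.εreg / ((F.P K).L : ℝ) ^ 2)) * ((F.P K).L : ℝ) ^ ((F.P K).d - 1) < deltaSU (Fin N))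
    {α : ℝ} (hαB : ((((F.P K).d + 2) * (F.P K).L : ℕ) : ℝ) ^ 2 / 4 *
      (2 * θ₀.ν.εreg / ((F.P K).L : ℝ) ^ 2 + 4 * max θ₀.ε₂₉ (10 * (((((F.P K).d + 2) * (F.P K).L : ℕ) : ℝ) * θ₀.ε₂₉) * ((F.P K).L : ℝ) ^ ((F.P K).d - 1))) < α)
    (hsolν : ∀ j < K, ∀ W ∈ domAltOfRecord F N θ₀.ν K (j + 1), UkExists F N K (j + 1) θ₀.ν.εreg W) :
    ∀ j < K, ∀ U : GaugeField (F.P K) j (SU N), (avOfRecord F N K j).avg U ∈ domAltOfRecord F N θ₀.ν K (j + 1) →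
      betaInputOfRecord F N T (chiβOfRecord₁₃ F N θ₀) K g j U ≠ 0 →
        U ∈ interior {W : GaugeField (F.P K) j (SU N) | (∀ c i, dist1 (loopHol W c i) ≤ α) ∧ ∀ p, dist1 (GaugeField.plaqHol W p) ≤
          2 * θ₀.ν.εreg / ((F.P K).L : ℝ) ^ 2 + 4 * max θ₀.ε₂₉ (10 * (((((F.P K).d + 2) * (F.P K).L : ℕ) : ℝ) * θ₀.ε₂₉) * ((F.P K).L : ℝ) ^ ((F.P K).d - 1))} := by
  intro j hj U havg hρ
  have hpos : 0 < betaInputOfRecord F N T (chiFixed29 F N θ₀.ν θ₀.ε₂₉) K g j U :=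
    lt_of_le_of_ne (betaInput_chi29_nonneg θ₀.ν θ₀.ε₂₉ T K g j U) (Ne.symm hρ)
  have hχ : chiFix29OfRecord F N θ₀.ν θ₀.ε₂₉ K j U = 1 := (betaInput_chi29_pos_iff θ₀.ν θ₀.ε₂₉ T K g j U).1 hpos
  exact mem_interior_localSupportSet_of_hsolν_of_numerics θ₀ K g hεreg hε3 hε2 hε29 hn1 hn2 hαB hsolν j hj U havg hχ

/-- **`K₀ j ⊆ domAltOfRecord θ₀.ν K j`** when the rider bound is STRICTLY below the small-field threshold, `B < ε₀` (the strict form of the threshold ordering `hord`).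
[cite: Balaban1987RG1, p.259 and (2.9) p.266] -/
theorem localSupportSet_subset_domAlt (j : ℕ) {α : ℝ}
    (hord : 2 * θ₀.ν.εreg / ((F.P K).L : ℝ) ^ 2 +
      4 * max θ₀.ε₂₉ (10 * (((((F.P K).d + 2) * (F.P K).L : ℕ) : ℝ) * θ₀.ε₂₉) * ((F.P K).L : ℝ) ^ ((F.P K).d - 1)) < θ₀.ν.ε₀) :
    {W : GaugeField (F.P K) j (SU N) | (∀ c i, dist1 (loopHol W c i) ≤ α) ∧ ∀ p, dist1 (GaugeField.plaqHol W p) ≤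
        2 * θ₀.ν.εreg / ((F.P K).L : ℝ) ^ 2 + 4 * max θ₀.ε₂₉ (10 * (((((F.P K).d + 2) * (F.P K).L : ℕ) : ℝ) * θ₀.ε₂₉) * ((F.P K).L : ℝ) ^ ((F.P K).d - 1))} ⊆
      domAltOfRecord F N θ₀.ν K j :=
  fun W hW => (mem_domAltOfRecord_iff F N θ₀.ν K j W).2 (plaqSmall_of_mem_of_lt hord W hW)

/-- **`K₀ j` lies in the loop α-guard** — FILE 1's binder `hK₀α` (projection). [cite: Balaban1987RG1, (0.4) p.253 (bookkeeping)] -/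
theorem localSupportSet_subset_loopGuard (j : ℕ) {α B : ℝ} :
    ∀ U ∈ {W : GaugeField (F.P K) j (SU N) | (∀ c i, dist1 (loopHol W c i) ≤ α) ∧ ∀ p, dist1 (GaugeField.plaqHol W p) ≤ B},
      ∀ c (i : Idx (F.P K)), dist1 (loopHol U c i) ≤ α :=
  fun _ hU => hU.1

/-! ## §4 FILE 1's boundedness clause `hρC` ON a closed set inside the domain — from compactness -/

/-- ★★ **THE β-INPUT IS BOUNDED ON EVERY CLOSED SET ON A NEIGHBOURHOOD OF WHICH `GF_k` AND `A_k` ARE CONTINUOUS** — FILE 1's binder `hρC : ∃ C₀, ∀ U ∈ K₀, ρ_k U ≤ C₀` for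
`ρ_k = betaInputOfRecord T (chiFixed29 ν ε₁) K g k = χ^{(2.9)}_k·exp[−GF_k∕g_k² + A_k]` (any `T`, `g`, `ν`, `ε₁`): the configuration space `SU(N)^{bonds}` is compact, so the closed `K₀`
is compact and the continuous body `exp[−GF_k∕g_k² + A_k]` is bounded on it, while `0 ≤ χ^{(2.9)}_k ≤ 1`.  `GF_k`∕`A_k` continuous on `D ⊇ K₀` is the tower's currency
(`D := domAlt_k`), DISPLAYED. [cite: Balaban1987RG1, (0.19) p.255 and p.259 (bookkeeping)] -/
theorem hρC_betaInput_chi29_of_continuousOn (ν : Stage7Numerics) (ε₁ : ℝ) (T : Transport F N) (g' : ℕ → ℝ) (k : ℕ)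
    {K₀ D : Set (GaugeField (F.P K) k (SU N))} (hK₀ : IsClosed K₀) (hK₀D : K₀ ⊆ D)
    (hGF : ContinuousOn (gfOfRecord F N K k) D) (hA : ContinuousOn (effActionHT F N T (chiFixed29 F N ν ε₁) K g' k) D) :
    ∃ C₀ : ℝ, ∀ U ∈ K₀, betaInputOfRecord F N T (chiFixed29 F N ν ε₁) K g' k U ≤ C₀ := by
  haveI : CompactSpace (GaugeField (F.P K) k (SU N)) := inferInstanceAs (CompactSpace (PBond (F.P K) k → SU N))
  have hcont : ContinuousOn (fun U : GaugeField (F.P K) k (SU N) =>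
      Real.exp (-(1 / (g' k) ^ 2) * gfOfRecord F N K k U + effActionHT F N T (chiFixed29 F N ν ε₁) K g' k U)) K₀ :=
    (Real.continuous_exp.comp_continuousOn ((continuousOn_const.mul hGF).add hA)).mono hK₀D
  obtain ⟨C, hC⟩ := hK₀.isCompact.exists_bound_of_continuousOn hcont
  refine ⟨C, fun U hU => ?_⟩
  rw [betaInput_chi29_apply]
  have hχ := chiFix29OfRecord_mem_Icc ν ε₁ K k U
  calc chiFix29OfRecord F N ν ε₁ K k U *
        Real.exp (-(1 / (g' k) ^ 2) * gfOfRecord F N K k U + effActionHT F N T (chiFixed29 F N ν ε₁) K g' k U)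
      ≤ 1 * Real.exp (-(1 / (g' k) ^ 2) * gfOfRecord F N K k U + effActionHT F N T (chiFixed29 F N ν ε₁) K g' k U) :=
        mul_le_mul_of_nonneg_right hχ.2 (Real.exp_pos _).le
    _ ≤ C := by
        rw [one_mul]
        exact (Real.le_norm_self _).trans (hC U hU)

/-- … at the Stage-13 letters, with `K₀ := «loops ≤ α ∧ plaquettes ≤ B»` inside `domAlt_j` (§3, `B < ε₀`) and the tower's `GF_j`∕`A_j` continuous on `domAltOfRecord θ₀.ν K j`:
FILE 1's `hρC` for the record's β-input over ANY transport `T`. [cite: Balaban1987RG1, (0.19) p.255 and p.259 (bookkeeping)] -/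
theorem hρC_betaInputOfRecord_localSupportSet_of_continuousOn (T : Transport F N) (j : ℕ) {α : ℝ}
    (hord : 2 * θ₀.ν.εreg / ((F.P K).L : ℝ) ^ 2 +
      4 * max θ₀.ε₂₉ (10 * (((((F.P K).d + 2) * (F.P K).L : ℕ) : ℝ) * θ₀.ε₂₉) * ((F.P K).L : ℝ) ^ ((F.P K).d - 1)) < θ₀.ν.ε₀)
    (hGF : ContinuousOn (gfOfRecord F N K j) (domAltOfRecord F N θ₀.ν K j))
    (hA : ContinuousOn (effActionHT F N T (chiβOfRecord₁₃ F N θ₀) K g j) (domAltOfRecord F N θ₀.ν K j)) :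
    ∃ C₀ : ℝ, ∀ U ∈ {W : GaugeField (F.P K) j (SU N) | (∀ c i, dist1 (loopHol W c i) ≤ α) ∧ ∀ p, dist1 (GaugeField.plaqHol W p) ≤
        2 * θ₀.ν.εreg / ((F.P K).L : ℝ) ^ 2 + 4 * max θ₀.ε₂₉ (10 * (((((F.P K).d + 2) * (F.P K).L : ℕ) : ℝ) * θ₀.ε₂₉) * ((F.P K).L : ℝ) ^ ((F.P K).d - 1))},
      betaInputOfRecord F N T (chiβOfRecord₁₃ F N θ₀) K g j U ≤ C₀ :=
  hρC_betaInput_chi29_of_continuousOn (K := K) θ₀.ν θ₀.ε₂₉ T g j (isClosed_loopLe_inter_plaqLe _ _)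
    (localSupportSet_subset_domAlt θ₀ K j hord) hGF hA

/-! ## §5 FILE 1's LOCAL continuity clause `hρc` from continuity of the critical configuration ON THE NEXT DOMAIN -/

/-- ★★ **THE LOCAL CONTINUITY CLAUSE OF FILE 1 FROM `hcrit` IN ITS ON-DOMAIN FORM.**  For the β-input `ρ_k = betaInputOfRecord T (chiFixed29 ν ε₁) K g k`: if the critical
configuration `W ↦ V^{(k)}(W)` is continuous ON an open set `D` of coarse fields (dag-n09-w1 g6's `hcritSel_domAlt_of_thm1_εbg_of_reg8` shape at `D := domAlt_{k+1}`, Sel edition;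
DISPLAYED for the record's bare choice), `GF_k` and `A_k` are continuous on an open `Dk ⊇ K₀`, and `K₀` lies in the loop α-guard with `α < δ_N`, then
`∀ U ∈ K₀, Ū U ∈ D → (∀ b, (∀ c, β(c) ≠ b) → fluctDev_k(U)(b) ≠ ε₁) → ContinuousAt ρ_k U` — FILE 1's `hρc` VERBATIM: the averaging is continuous at guard points
(dag-n09-w4's `continuousAt_avgFun_of_small`), so the critical letters `V ↦ V^{(k)}(V̄)(b)` are continuous at `U`, and dag-n09-w2 g5's `continuousAt_betaInput_chi29_of_forall_ne`
applies. [cite: Balaban1987RG1, (0.4) p.253, (0.19) p.255, (2.3) p.265 and (2.9) p.266] -/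
theorem hρc_betaInput_chi29_local_of_continuousOn_crit (ν : Stage7Numerics) (ε₁ : ℝ) (T : Transport F N) (g' : ℕ → ℝ) {k : ℕ}
    {K₀ Dk : Set (GaugeField (F.P K) k (SU N))} {D : Set (GaugeField (F.P K) (k + 1) (SU N))} (hD : IsOpen D) (hDk : IsOpen Dk) (hK₀Dk : K₀ ⊆ Dk)
    {α : ℝ} (hαδ : α < deltaSU (Fin N)) (hK₀α : ∀ U ∈ K₀, ∀ c (i : Idx (F.P K)), dist1 (loopHol U c i) ≤ α)
    (hcrit : ContinuousOn (critCfgOfRecord F N ν K k) D)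
    (hGF : ContinuousOn (gfOfRecord F N K k) Dk) (hA : ContinuousOn (effActionHT F N T (chiFixed29 F N ν ε₁) K g' k) Dk) :
    ∀ U ∈ K₀, (avOfRecord F N K k).avg U ∈ D →
      (∀ b : PBond (F.P K) k, (∀ c : PBond (F.P K) (k + 1), centralBond c ≠ b) → fluctDevOfRecord F N ν K k U b ≠ ε₁) →
        ContinuousAt (betaInputOfRecord F N T (chiFixed29 F N ν ε₁) K g' k) U := by
  intro U hU hUD hne
  have hsmall : ∀ c, Small (expMeanLogSU (n := Fin N)) U c := fun c i => lt_of_le_of_lt (hK₀α U hU c i) hαδ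
  have havg : ContinuousAt (avOfRecord F N K k).avg U := continuousAt_avgFun_of_small (P := F.P K) (j := k) U hsmall
  have hcritU : ContinuousAt (fun V : GaugeField (F.P K) k (SU N) => critCfgOfRecord F N ν K k ((avOfRecord F N K k).avg V)) U :=
    ContinuousAt.comp (f := (avOfRecord F N K k).avg) (hcrit.continuousAt (hD.mem_nhds hUD)) havg
  have hcont : ∀ b : PBond (F.P K) k, ¬ IsB0 b →
      ContinuousAt (fun V : GaugeField (F.P K) k (SU N) => fluctDevOfRecord F N ν K k V b) U :=
    fun b _ => continuousAt_fluctDevOfRecord_of_continuousAt_crit ν b ((continuous_apply b).continuousAt.comp hcritU)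
  exact continuousAt_betaInput_chi29_of_forall_ne ν ε₁ T K g' k hcont (fun b hb => hne b ((not_isB0_iff b).1 hb))
    (hGF.continuousAt (hDk.mem_nhds (hK₀Dk hU))) (hA.continuousAt (hDk.mem_nhds (hK₀Dk hU)))

/-- … at the Stage-13 letters with `K₀ := «loops ≤ α ∧ plaquettes ≤ B»` (`⊆ domAlt_j` by `B < ε₀`), `Dk := domAltOfRecord θ₀.ν K j`, `D := domAltOfRecord θ₀.ν K (j+1)`: FILE 1's `hρc` for the
record's β-input over ANY transport `T`, from `hcrit` ON THE NEXT DOMAIN + the tower's `GF_j`∕`A_j` continuity on `domAlt_j` + `α < δ_N`. [cite: Balaban1987RG1, (0.19) p.255, p.259, (2.3) p.265 and (2.9) p.266] -/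
theorem hρc_betaInputOfRecord_localSupportSet_of_continuousOn_crit (T : Transport F N) (j : ℕ) {α : ℝ} (hαδ : α < deltaSU (Fin N))
    (hord : 2 * θ₀.ν.εreg / ((F.P K).L : ℝ) ^ 2 +
      4 * max θ₀.ε₂₉ (10 * (((((F.P K).d + 2) * (F.P K).L : ℕ) : ℝ) * θ₀.ε₂₉) * ((F.P K).L : ℝ) ^ ((F.P K).d - 1)) < θ₀.ν.ε₀)
    (hcrit : ContinuousOn (critCfgOfRecord F N θ₀.ν K j) (domAltOfRecord F N θ₀.ν K (j + 1)))
    (hGF : ContinuousOn (gfOfRecord F N K j) (domAltOfRecord F N θ₀.ν K j))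
    (hA : ContinuousOn (effActionHT F N T (chiβOfRecord₁₃ F N θ₀) K g j) (domAltOfRecord F N θ₀.ν K j)) :
    ∀ U ∈ {W : GaugeField (F.P K) j (SU N) | (∀ c i, dist1 (loopHol W c i) ≤ α) ∧ ∀ p, dist1 (GaugeField.plaqHol W p) ≤
        2 * θ₀.ν.εreg / ((F.P K).L : ℝ) ^ 2 + 4 * max θ₀.ε₂₉ (10 * (((((F.P K).d + 2) * (F.P K).L : ℕ) : ℝ) * θ₀.ε₂₉) * ((F.P K).L : ℝ) ^ ((F.P K).d - 1))},
      (avOfRecord F N K j).avg U ∈ domAltOfRecord F N θ₀.ν K (j + 1) →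
        (∀ b : PBond (F.P K) j, (∀ c : PBond (F.P K) (j + 1), centralBond c ≠ b) → fluctDevOfRecord F N θ₀.ν K j U b ≠ θ₀.ε₂₉) →
          ContinuousAt (betaInputOfRecord F N T (chiβOfRecord₁₃ F N θ₀) K g j) U :=
  hρc_betaInput_chi29_local_of_continuousOn_crit (K := K) θ₀.ν θ₀.ε₂₉ T g
    (B12ContinuousTransportInvarianceOn.isOpen_domAltOfRecord θ₀.ν K (j + 1)) (B12ContinuousTransportInvarianceOn.isOpen_domAltOfRecord θ₀.ν K j)
    (localSupportSet_subset_domAlt θ₀ K j hord) hαδ (localSupportSet_subset_loopGuard (F := F) (N := N) K j) hcrit hGF hA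

end Summit.QuantumFields.YangMills.BalabanUVNodes.N09LocalSupportSetAtRecord

end
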